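import Mathlib
import HarnessLib

/-!
# An explicit bound on the first derivative of Mathlib's `Real.smoothTransition`: `|smoothTransition′(x)| ≤ 3` for every `x`

Topic `Analysis/Calculus`.  The Gevrey table of `ExpNegInvGlueGevrey` gives `|smoothTransition^{(n)}| ≤ 8·(n!)²·256ⁿ` for ALL `n` — at `n = 1` the crude
`2048`.  The first derivative enters the single-scale LIPSCHITZ lines of the fermionic multiscale bookkeeping linearly (`|χ₂(a) − χ₂(b)| ≤ B₁|a − b|`, e.g.
`abs_uvWeightFn_sub_le`; cell gate-hubbard-kl: the frame-response door's `hB : |χ₂′| ≤ B₁` multiplies the MAIN term by `(200 + 200B₁)`), so a realistic `B₁`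
is worth a separate elementary computation.  With `E = expNegInvGlue`, `D = E + E(1−·)`, the closed form
`smoothTransition′(x) = E(x)·E(1−x)·(x⁻² + (1−x)⁻²)/D(x)²` holds at EVERY `x` (Mathlib's `E′(x) = x⁻²E(x)` everywhere), and
(i) on `[1/3, 2/3]`: `E·E(1−·)/D² ≤ 1/4`, `x⁻² + (1−x)⁻² ≤ 12` (four sub-intervals); (ii) on `(0, 1/3)`: `E·E(1−·)/D² ≤ E(x)/E(1−x) = e^{(1−x)⁻¹ − x⁻¹} ≤ e^{3/2 − a}`,
`a = x⁻¹ ≥ 3`, and `e^{3/2−a}(a² + 9/4) ≤ 3` (`e^{3/2} ≥ e·13/8`, `e^u ≥ 1 + u + u²/2`); (iii) `(2/3, 1)` symmetric; off `(0,1)` the derivative vanishes.  True supremum: `2`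
(at `x = 1/2`).

* `deriv_smoothTransition_eq` — the closed form (Mathlib's `E′ = x⁻²E` everywhere + the quotient rule);
* `exp_mul_sq_add_le_three` — `e^{3/2 − a}(a² + 9/4) ≤ 3` for `a ≥ 3`;
* **`abs_deriv_smoothTransition_le_three`** — `|smoothTransition′(x)| ≤ 3` for all `x`.

Everything is proved; no definitions; no named facts.

## Sources

M. Disertori, V. Rivasseau, Commun. Math. Phys. 215 (2000) 251–290, §II.2 (II.13)–(II.14) (`DisertoriRivasseau2000`; the smooth cutoff and its constants);
G. Benfatto, A. Giuliani, V. Mastropietro, Ann. Henri Poincaré 7 (2006) 809–898, §2.2 (2.9) (`BenfattoGiulianiMastropietro2006`).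
-/

noncomputable section

namespace Literature.Analysis.Calculus

open Real Polynomial

/-- **The closed form of `smoothTransition′`** at every `x`: `deriv smoothTransition x = E(x)·E(1−x)·(x⁻² + (1−x)⁻²)/(E(x) + E(1−x))²`
(the `HasDerivAt` forms of `E′ = x⁻²E` and of this quotient rule already live in the tree — `Literature.Topology.FourManifolds.HandleOne.hasDerivAt_expNegInvGlue`,
`Literature.NumberTheory.Sieve.GreenTao2008.hasDerivAt_smoothTransition` — in modules this calculus file should not import; the five-line derivation is inlined).
[cite: DisertoriRivasseau2000, §II.2 (II.14) footnote p0004:L18–26] -/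
theorem deriv_smoothTransition_eq (x : ℝ) :
    deriv Real.smoothTransition x =
      expNegInvGlue x * expNegInvGlue (1 - x) * (x⁻¹ ^ 2 + (1 - x)⁻¹ ^ 2) / (expNegInvGlue x + expNegInvGlue (1 - x)) ^ 2 := by
  have hE : ∀ y : ℝ, HasDerivAt expNegInvGlue (y⁻¹ ^ 2 * expNegInvGlue y) y := fun y => by
    have h := expNegInvGlue.hasDerivAt_polynomial_eval_inv_mul 1 y
    simp only [eval_one, one_mul, derivative_one, sub_zero, mul_one, eval_pow, eval_X] at h
    exact h
  have hE1 : HasDerivAt (fun y => expNegInvGlue (1 - y)) ((1 - x)⁻¹ ^ 2 * expNegInvGlue (1 - x) * (-1)) x := by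
    have h1 : HasDerivAt (fun y : ℝ => 1 - y) (-1) x := by simpa using (hasDerivAt_id x).const_sub (1 : ℝ)
    exact (hE (1 - x)).comp x h1
  have hD : HasDerivAt (fun y => expNegInvGlue y + expNegInvGlue (1 - y))
      (x⁻¹ ^ 2 * expNegInvGlue x + (1 - x)⁻¹ ^ 2 * expNegInvGlue (1 - x) * (-1)) x := (hE x).add hE1
  have hDne : expNegInvGlue x + expNegInvGlue (1 - x) ≠ 0 := (Real.smoothTransition.pos_denom x).ne'
  have hq := (hE x).div hD hDne
  have hfun : (expNegInvGlue / fun y => expNegInvGlue y + expNegInvGlue (1 - y)) = Real.smoothTransition := by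
    funext y; rfl
  rw [hfun] at hq
  rw [hq.deriv]
  field_simp
  ring

/-- The arithmetic of the tails: `e^{3/2 − a}·(a² + 9/4) ≤ 3` for `a ≥ 3` (`e^{3/2} ≥ e·13/8 ≥ 4.41`, `e^u ≥ 1 + u + u²/2`).
[cite: DisertoriRivasseau2000, §II.2 (II.14) footnote p0004:L18–26] -/
theorem exp_mul_sq_add_le_three {a : ℝ} (ha : 3 ≤ a) : exp (3 / 2 - a) * (a ^ 2 + 9 / 4) ≤ 3 := by
  set u : ℝ := a - 3 with hu
  have hu0 : 0 ≤ u := by linarith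
  have he1 : (2.7182818283 : ℝ) < exp 1 := Real.exp_one_gt_d9
  have hehalf : (13 : ℝ) / 8 ≤ exp (1 / 2) := by
    have h := Real.quadratic_le_exp_of_nonneg (show (0 : ℝ) ≤ 1 / 2 by norm_num)
    nlinarith
  have he32 : (4.41 : ℝ) ≤ exp (3 / 2) := by
    have h : exp (3 / 2 : ℝ) = exp 1 * exp (1 / 2) := by rw [← Real.exp_add]; norm_num
    rw [h]; nlinarith [exp_pos (1 : ℝ), exp_pos (1 / 2 : ℝ)]
  have heu : 1 + u + u ^ 2 / 2 ≤ exp u := Real.quadratic_le_exp_of_nonneg hu0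
  -- `e^{3/2 − a} = (e^{3/2}·e^{u})⁻¹·e^{3}·…` — work multiplicatively: `e^{3/2−a}·e^{u}·e^{3/2} = e^{3 − a + u} = 1`
  have hprod : exp (3 / 2 - a) * (exp (3 / 2) * exp u) = 1 := by
    have h0 : 3 / 2 - a + (3 / 2 + u) = 0 := by rw [hu]; ring
    rw [← Real.exp_add, ← Real.exp_add, h0, Real.exp_zero]
  have hpos : 0 < exp (3 / 2) * exp u := by positivity
  -- it suffices that `a² + 9/4 ≤ 3·e^{3/2}·e^{u}`
  have hmain : a ^ 2 + 9 / 4 ≤ 3 * (exp (3 / 2) * exp u) := by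
    have ha' : a = u + 3 := by rw [hu]; ring
    rw [ha']
    nlinarith [mul_le_mul he32 heu (by positivity) (by positivity), sq_nonneg u]
  calc exp (3 / 2 - a) * (a ^ 2 + 9 / 4) ≤ exp (3 / 2 - a) * (3 * (exp (3 / 2) * exp u)) := by gcongr
    _ = 3 * (exp (3 / 2 - a) * (exp (3 / 2) * exp u)) := by ring
    _ = 3 := by rw [hprod, mul_one]

/-- **`|smoothTransition′(x)| ≤ 3` for every `x`** (true supremum `2` at `x = 1/2`). [cite: DisertoriRivasseau2000, §II.2 (II.14) footnote p0004:L18–26] -/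
theorem abs_deriv_smoothTransition_le_three (x : ℝ) : |deriv Real.smoothTransition x| ≤ 3 := by
  rw [deriv_smoothTransition_eq]
  set E : ℝ := expNegInvGlue x with hE
  set F : ℝ := expNegInvGlue (1 - x) with hF
  have hE0 : 0 ≤ E := expNegInvGlue.nonneg x
  have hF0 : 0 ≤ F := expNegInvGlue.nonneg (1 - x)
  have hD : 0 < E + F := Real.smoothTransition.pos_denom x
  have hS0 : 0 ≤ x⁻¹ ^ 2 + (1 - x)⁻¹ ^ 2 := by positivity
  rw [abs_of_nonneg (by positivity)]
  -- the ratio `E·F/(E+F)²` and the symmetric sum `S`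
  have hratio : E * F / (E + F) ^ 2 ≤ 1 / 4 := by
    rw [div_le_iff₀ (by positivity)]; nlinarith [sq_nonneg (E - F)]
  have hkey : ∀ {S : ℝ}, 0 ≤ S → S ≤ 12 → E * F * S / (E + F) ^ 2 ≤ 3 := by
    intro S hS hS12
    calc E * F * S / (E + F) ^ 2 = E * F / (E + F) ^ 2 * S := by ring
      _ ≤ 1 / 4 * 12 := by gcongr
      _ = 3 := by norm_num
  rcases le_or_gt x 0 with hx0 | hx0
  · -- `x ≤ 0`: `E = 0`
    have : E = 0 := expNegInvGlue.zero_of_nonpos hx0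
    rw [this]; simp
  rcases le_or_gt 1 x with hx1 | hx1
  · -- `x ≥ 1`: `F = 0`
    have : F = 0 := expNegInvGlue.zero_of_nonpos (by linarith)
    rw [this]; simp
  -- `0 < x < 1`
  have hx1' : 0 < 1 - x := by linarith
  have hEexp : E = exp (-x⁻¹) := by simp [hE, expNegInvGlue, not_le.2 hx0]
  have hFexp : F = exp (-(1 - x)⁻¹) := by simp [hF, expNegInvGlue, not_le.2 hx1']
  have hEpos : 0 < E := by rw [hEexp]; exact exp_pos _
  have hFpos : 0 < F := by rw [hFexp]; exact exp_pos _
  rcases lt_or_ge x (1 / 3) with hlt | hge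
  · -- (ii) `0 < x < 1/3`: `E F S/(E+F)² ≤ (E/F)·S ≤ e^{3/2 − a}(a² + 9/4) ≤ 3`, `a = x⁻¹ ≥ 3`
    have ha : 3 ≤ x⁻¹ := by rw [le_inv_comm₀ (by norm_num) hx0]; linarith
    have hb : (1 - x)⁻¹ ≤ 3 / 2 := by rw [inv_le_comm₀ hx1' (by norm_num)]; linarith
    have hb0 : 0 < (1 - x)⁻¹ := inv_pos.2 hx1'
    have hS : x⁻¹ ^ 2 + (1 - x)⁻¹ ^ 2 ≤ x⁻¹ ^ 2 + 9 / 4 := by nlinarith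
    have hEF : E * F / (E + F) ^ 2 ≤ exp (3 / 2 - x⁻¹) := by
      have h1 : E * F / (E + F) ^ 2 ≤ E / F := by
        rw [div_le_div_iff₀ (by positivity) hFpos]
        nlinarith [mul_nonneg (mul_nonneg hE0 hE0) hE0, mul_nonneg (mul_nonneg hE0 hE0) hF0]
      have h2 : E / F = exp ((1 - x)⁻¹ - x⁻¹) := by rw [hEexp, hFexp, ← Real.exp_sub]; ring_nf
      have h3 : exp ((1 - x)⁻¹ - x⁻¹) ≤ exp (3 / 2 - x⁻¹) := Real.exp_le_exp.2 (by linarith)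
      exact h1.trans (h2 ▸ h3)
    calc E * F * (x⁻¹ ^ 2 + (1 - x)⁻¹ ^ 2) / (E + F) ^ 2 = E * F / (E + F) ^ 2 * (x⁻¹ ^ 2 + (1 - x)⁻¹ ^ 2) := by ring
      _ ≤ exp (3 / 2 - x⁻¹) * (x⁻¹ ^ 2 + 9 / 4) := by gcongr
      _ ≤ 3 := exp_mul_sq_add_le_three ha
  rcases lt_or_ge (2 / 3 : ℝ) x with hgt | hle
  · -- (iii) `2/3 < x < 1`: symmetric, `b = (1−x)⁻¹ ≥ 3`
    have hb : 3 ≤ (1 - x)⁻¹ := by rw [le_inv_comm₀ (by norm_num) hx1']; linarith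
    have ha : x⁻¹ ≤ 3 / 2 := by rw [inv_le_comm₀ hx0 (by norm_num)]; linarith
    have ha0 : 0 < x⁻¹ := inv_pos.2 hx0
    have hS : x⁻¹ ^ 2 + (1 - x)⁻¹ ^ 2 ≤ (1 - x)⁻¹ ^ 2 + 9 / 4 := by nlinarith
    have hEF : E * F / (E + F) ^ 2 ≤ exp (3 / 2 - (1 - x)⁻¹) := by
      have h1 : E * F / (E + F) ^ 2 ≤ F / E := by
        rw [div_le_div_iff₀ (by positivity) hEpos]
        nlinarith [mul_nonneg (mul_nonneg hF0 hF0) hF0, mul_nonneg (mul_nonneg hF0 hF0) hE0]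
      have h2 : F / E = exp (x⁻¹ - (1 - x)⁻¹) := by rw [hEexp, hFexp, ← Real.exp_sub]; ring_nf
      have h3 : exp (x⁻¹ - (1 - x)⁻¹) ≤ exp (3 / 2 - (1 - x)⁻¹) := Real.exp_le_exp.2 (by linarith)
      exact h1.trans (h2 ▸ h3)
    calc E * F * (x⁻¹ ^ 2 + (1 - x)⁻¹ ^ 2) / (E + F) ^ 2 = E * F / (E + F) ^ 2 * (x⁻¹ ^ 2 + (1 - x)⁻¹ ^ 2) := by ring
      _ ≤ exp (3 / 2 - (1 - x)⁻¹) * ((1 - x)⁻¹ ^ 2 + 9 / 4) := by gcongr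
      _ ≤ 3 := exp_mul_sq_add_le_three hb
  -- (i) `1/3 ≤ x ≤ 2/3`: `S ≤ 12` on four sub-intervals
  refine hkey hS0 ?_
  have hxinv : ∀ {c : ℝ}, 0 < c → c ≤ x → x⁻¹ ≤ c⁻¹ := fun hc hcx => by rwa [inv_le_inv₀ hx0 hc]
  have hyinv : ∀ {c : ℝ}, 0 < c → c ≤ 1 - x → (1 - x)⁻¹ ≤ c⁻¹ := fun hc hcx => by rwa [inv_le_inv₀ hx1' hc]
  have hix0 : 0 < x⁻¹ := inv_pos.2 hx0
  have hiy0 : 0 < (1 - x)⁻¹ := inv_pos.2 hx1'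
  rcases le_or_gt x (2 / 5) with h25 | h25
  · -- `[1/3, 2/5]`: `x⁻¹ ≤ 3`, `(1−x)⁻¹ ≤ 5/3`
    have h1 : x⁻¹ ≤ 3 := by have := hxinv (by norm_num : (0 : ℝ) < 1 / 3) hge; norm_num at this; exact this
    have h2 : (1 - x)⁻¹ ≤ 5 / 3 := by have := hyinv (by norm_num : (0 : ℝ) < 3 / 5) (by linarith); norm_num at this; exact this
    nlinarith
  rcases le_or_gt x (1 / 2) with h12 | h12
  · -- `[2/5, 1/2]`: `x⁻¹ ≤ 5/2`, `(1−x)⁻¹ ≤ 2`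
    have h1 : x⁻¹ ≤ 5 / 2 := by have := hxinv (by norm_num : (0 : ℝ) < 2 / 5) h25.le; norm_num at this; exact this
    have h2 : (1 - x)⁻¹ ≤ 2 := by have := hyinv (by norm_num : (0 : ℝ) < 1 / 2) (by linarith); norm_num at this; exact this
    nlinarith
  rcases le_or_gt x (3 / 5) with h35 | h35
  · -- `[1/2, 3/5]`: `x⁻¹ ≤ 2`, `(1−x)⁻¹ ≤ 5/2`
    have h1 : x⁻¹ ≤ 2 := by have := hxinv (by norm_num : (0 : ℝ) < 1 / 2) h12.le; norm_num at this; exact this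
    have h2 : (1 - x)⁻¹ ≤ 5 / 2 := by have := hyinv (by norm_num : (0 : ℝ) < 2 / 5) (by linarith); norm_num at this; exact this
    nlinarith
  · -- `[3/5, 2/3]`: `x⁻¹ ≤ 5/3`, `(1−x)⁻¹ ≤ 3`
    have h1 : x⁻¹ ≤ 5 / 3 := by have := hxinv (by norm_num : (0 : ℝ) < 3 / 5) h35.le; norm_num at this; exact this
    have h2 : (1 - x)⁻¹ ≤ 3 := by have := hyinv (by norm_num : (0 : ℝ) < 1 / 3) (by linarith); norm_num at this; exact this
    nlinarith

end Literature.Analysis.Calculus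

end
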